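import Summits.Ventures.AbcSig.Levels.N5792P1
import Summits.Ventures.AbcSig.Levels.N5792P2

/-!
# Venture AbcSig — GENERATED level file, level 5792 (AGGREGATOR of 2 part files)

HONEST FRAMING. As in the part files `N5792<part>.lean`, parts P1, P2 (a MIXED split: parts of
different size-splits of the same generator output landed in the tree at different times; every part carries the orbit
blocks of one contiguous run of orbits of the same certified level file `N5792.engine1.json`,
sha256 `a1a3c139627a5b8f4af36186b17ea495fb1835d36d86b307dee464d70c32e925`): this file only concatenates the orbit lists and the part summaries into
`level5792Orbits`, `level5792_wellformed`, `level5792_sieve` (the shapes the row templates consume). The split exists because the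
tree's files are ≤ 400 lines and ≤ 200 000 bytes. Union of residual exponents ≥ 7: [7, 31, 41]; orbits not eliminable by
the sieve: none. No Diophantine statement is made here; no claim on ABC or any summit.
-/

namespace Summit.Ventures.AbcSig

/-- All newform orbits of level 5792 (concatenation of the parts, engine order). -/
def level5792Orbits : List OrbitData :=
  level5792OrbitsP1 ++ level5792OrbitsP2

/-- Every listed entry is at an odd prime not dividing 5792. -/
theorem level5792_wellformed :
    ∀ o ∈ level5792Orbits, ∀ e ∈ o.coeffs, e.ell.Prime ∧ e.ell ≠ 2 ∧ ¬ e.ell ∣ 5792 := by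
  unfold level5792Orbits
  exact List.forall_mem_append.2 ⟨level5792_wellformedP1, level5792_wellformedP2⟩

/-- **Level 5792 summary.** For a prime exponent `n ≥ 7`, every orbit of level 5792 is sieve-eliminated by the
kernel certificates of the part files, except that the row's predicate `X` is assumed for: orbit_5792_1 if n ∈ [7], orbit_5792_2 if n ∈ [7], orbit_5792_7 if n ∈ [7], orbit_5792_8 if n ∈ [7], orbit_5792_11 if n ∈ [31, 41], orbit_5792_12 if n ∈ [7]. -/
theorem level5792_sieve (n : ℕ) (hn : n.Prime) (hmin : 7 ≤ n) (X : OrbitData → Prop)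
    (h_orbit_5792_1 : n ∈ ([7] : List ℕ) → X orbit_5792_1)
    (h_orbit_5792_2 : n ∈ ([7] : List ℕ) → X orbit_5792_2)
    (h_orbit_5792_7 : n ∈ ([7] : List ℕ) → X orbit_5792_7)
    (h_orbit_5792_8 : n ∈ ([7] : List ℕ) → X orbit_5792_8)
    (h_orbit_5792_11 : n ∈ ([31, 41] : List ℕ) → X orbit_5792_11)
    (h_orbit_5792_12 : n ∈ ([7] : List ℕ) → X orbit_5792_12) :
    ∀ o ∈ level5792Orbits, (∀ e ∈ o.coeffs, e.ell.Prime ∧ e.ell ≠ 2 ∧ ¬ e.ell ∣ 5792) ∧ (o.Eliminated bs04Allowed n ∨ X o) := by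
  unfold level5792Orbits
  exact List.forall_mem_append.2 ⟨(level5792_sieveP1 n hn hmin X h_orbit_5792_1 h_orbit_5792_2 h_orbit_5792_7 h_orbit_5792_8 h_orbit_5792_11), (level5792_sieveP2 n hn hmin X h_orbit_5792_12)⟩

end Summit.Ventures.AbcSig
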